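import Summits.BirchSwinnertonDyer.BirchSwinnertonDyer.Theorems.SchneiderFreeAdditiveX3OrdinaryLineCharacter
import Summits.BirchSwinnertonDyer.BirchSwinnertonDyer.Theorems.SchneiderFreeAdditiveX3LocalTowerTorsionFiniteOfUnitRoot
import HarnessLib

/-!
# The F-record `LocalTowerTorsionFiniteX3F` (stmt-BirchSwinnertonDyer-19668) CLOSED by name
# (route `SchneiderFreeAdditiveX3`, seat `bsd-schneider-door-c6` gen 3)

`LocalTowerTorsionFiniteX3F := (∀ K p, ZpExtension.exists_isFrobPow_mem_kerSubgroup_of_isAnticyclotomic K p)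
→ LocalTowerTorsionFiniteX3` (Fin_v on every cell of the K1 door under the ONE cite-only local class
field theory fact): the composite of door-c5 g6's glue `localTowerTorsionFiniteX3F_of_unitRoot`
(p457466: FILE 2 `…LineCharacterTwist` p457112 ∘ FILE 3 `…LineCharacterBaseChange` p457099 ∘ door-c2
g5's (M) half p452324 / A41 `_holds`) with FILE 1 `unitRootCharacter` (`…OrdinaryLineCharacter`: the
unit-root Frobenius character `χ_p · α^{-n}` of Greenberg's reduction line, Greenberg LNM 1716 §2
p. 70).  A RECORD of the control corner, off the leaf's critical path (p447721); closing it does not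
advance BSD.  Proof only; no definition, no named fact, no `sorry`.
-/

namespace Summit.BirchSwinnertonDyer.BirchSwinnertonDyer.Theorems.SchneiderFreeAdditiveX3

set_option linter.dupNamespace false

/-- **Item stmt-BirchSwinnertonDyer-19668 `LocalTowerTorsionFiniteX3F`, proved**: Fin_v —
`E(K̄)[p^∞]^{D_𝔭 ⊓ Gal(K̄/K_∞^ac)}` finite at `𝔭 ∣ p` split, on every cell of the door (X3 ∩
semistable-twist, `r_an = 1`, `p` odd) — from the cite-only norm-residue-symbol fact
`ZpExtension.exists_isFrobPow_mem_kerSubgroup_of_isAnticyclotomic` alone; everything else (the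
canonical line with its character on both cells, its twist and base-change transports, the weight
argument) is in the tree. [cite: JetchevSkinnerWan2017, §3.3 Prop. 3.3.4 Case 3(b), Remark 3.3.5 (arXiv:1512.06894 p. 13)]
[cite: GreenbergLNM1716, §2 p. 70 (after Prop. 2.4)] -/
theorem localTowerTorsionFiniteX3F_proof :
    Summit.BirchSwinnertonDyer.BirchSwinnertonDyer.Theses.SchneiderFreeAdditiveX3.LocalTowerTorsionFiniteX3F :=
  localTowerTorsionFiniteX3F_of_unitRoot unitRootCharacter

end Summit.BirchSwinnertonDyer.BirchSwinnertonDyer.Theorems.SchneiderFreeAdditiveX3
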